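import Mathlib.Analysis.Distribution.SchwartzSpace.Basic
import Mathlib.Analysis.SpecialFunctions.Pow.Real
import Literature.MathematicalPhysics.QuantumLattice.RandomField
import Literature.MathematicalPhysics.QuantumLattice.EuclideanAction
import Literature.MathematicalPhysics.QuantumLattice.SchwartzTensor
import Literature.MathematicalPhysics.QuantumLattice.OSAxiomsMeasure
import HarnessLib

-- provenance: harness21/H21/H21/Prelude/QLatticeAQFT/SchwingerOSAxioms.lean @ 1052202 (interim HEAD d8f2665); M5 mechanical rewrite
/-!
# Osterwalder–Schrader axioms for Schwinger families (distributional form)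

Trunk **T-AQFT** (G13, Part A, item A6 / design decision A-D1), families `constructive-qft`,
`crit-ising`. Notions: `os_axioms` (OS 1973/75 form), `schwinger_functions`.

For a Schwinger family `𝔖 = (𝔖ₙ)ₙ`, `𝔖ₙ ∈ 𝒮'((ℝ^d)^n)` (`Literature.MathematicalPhysics.QuantumLattice.SchwingerFamily`), the axioms of
Osterwalder–Schrader are

* **E0** (temperedness) `𝔖₀ = 1`, `𝔖ₙ ∈ 𝒮'`: temperedness is automatic for continuous linear
  functionals on `𝓢` (`SchwingerFamily.exists_bound`); the normalisation `𝔖₀ = 1` is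
  `SchwingerFamily.IsNormalized`;
* **E0'** (linear growth, OS II): `|𝔖ₙ(f)| ≤ σₙ |f|_{ns}` with `σₙ ≤ α (n!)^β` —
  `SchwingerFamily.HasLinearGrowth`, using the Schwartz norm `schwartzNorm m f = sup_{k,l ≤ m}
  sup_x ‖x‖^k ‖D^l f(x)‖`;
* **E1** (Euclidean invariance) — `SchwingerFamily.IsEuclideanCovariant`;
* **E2** (reflection positivity) `∑ₙₘ 𝔖ₙ₊ₘ(Θfₙ* ⊗ fₘ) ≥ 0` — `SchwingerFamily.IsOSReflectionPositive`;
* **E3** (symmetry) — `SchwingerFamily.IsSymmetric` (from `SchwartzTensor`);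
* **E4** (cluster property) — `SchwingerFamily.HasClusterProperty`.

`structure SchwingerFamily.IsOSFamily` bundles the normalisation `𝔖₀ = 1` and E1–E4 ONLY; the
growth condition E0' is kept as a *separate hypothesis* wherever needed (outline A6, review F12e:
this is closer to OS II, whose reconstruction theorem reads "E0' ∧ E1–E4 ⇒ Wightman", and lets
`constructive-qft.S06` be stated without E0'). Bridges to the measure form (`OSAxiomsMeasure`),
as named facts (`def … : Prop`, D-0014): `IsOSMeasure.exists_isOSFamily`,
`IsSchwingerFamilyOf.isOSReflectionPositive`, `IsSchwingerFamilyOf.isSymmetric`,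
`IsSchwingerFamilyOf.isEuclideanCovariant`, `IsSchwingerFamilyOf.hasClusterProperty`;
`IsSchwingerFamilyOf.isNormalized` is proved. Section *Assembly*:
`IsOSMeasure.exists_isOSFamily_of` reduces `exists_isOSFamily` to the kernel theorem
(`existsUnique_schwingerFamilyOf`) and the four bridges E1–E4. Section *Density*: the named fact
`denseSpan_tensorProducts` (tensor products of real test functions are total in `𝓢(Eⁿ)`,
Reed–Simon I Thm V.13) and, from it, proofs of the E1 and E3 bridges and of the uniqueness of
the Schwinger family (`isEuclideanCovariant_of_denseSpan`, `isSymmetric_of_denseSpan`,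
`IsSchwingerFamilyOf.unique_of_denseSpan`).

## Sources

* K. Osterwalder, R. Schrader, *Axioms for Euclidean Green's functions*, Comm. Math. Phys. 31
  (1973) 83–112, §3 (axioms E0–E4), §4 ((E2) in the form (4.2)).
* K. Osterwalder, R. Schrader, *Axioms for Euclidean Green's functions II*, Comm. Math. Phys. 42
  (1975) 281–305, §2 (the linear growth condition (E0') and the norms `|f|_m`), Theorem E'.
* J. Glimm, A. Jaffe, *Quantum Physics: a functional integral point of view* (2nd ed. 1987),
  §6.1 (measure form OS0–OS4, Schwinger functions as moments), §19.1 (from OS measures to the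
  distributional axioms; growth of Schwinger functions, Thm 19.1.1 ff.).

## Mathlib

Used: `schwartzSeminormFamily`, `Finset.sup` of seminorms on `Finset.Iic (m, m)` (the standard
Mathlib idiom, cf. `SchwartzMap.one_add_le_sup_seminorm_apply`), `Real.rpow`, `Nat.factorial`,
`Filter.Tendsto`. Searched and absent at the pin: any Osterwalder–Schrader vocabulary
(`Osterwalder`, `reflectionPositiv`, `linearGrowth`, `clusterProperty`), a named "Schwartz norm of
order `m`" (only the `Finset.sup` idiom exists, which we name `schwartzNorm`).

## Design

* Fixed dimension is written `EuclideanSpace ℝ (Fin d)` with `[NeZero d]` (time = coordinate `0`,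
  outline §0); `E1`, `E3`, `E0'` and normalisation are stated over a generic real normed space.
* Witness form (A-D1, R1): tensor products enter only through `IsAppendTensorOf`; non-vacuity is
  `exists_isAppendTensorOf` (`SchwartzTensor`).
* E1 is invariance under all translations `translateMulti a` and all linear isometries
  `linActMulti L` (full `O(d)`, the Glimm–Jaffe OS2 convention, as fixed by the outline); OS 1973
  only ask for `SO(d)`. Documented strengthening, harmless for scalar `P(φ)`-type models.
* E2 in OS's "finite sequence" form: a sequence `F : (n : ℕ) → 𝓢(((ℝ^d)^n), ℂ)` vanishing above
  `N`, summed over `Finset.range (N + 1)`; "`≥ 0`" for a complex number `z` is `0 ≤ z.re ∧ z.im = 0`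
  (as in `IsOS3ReflectionPositive`).
* E4 is stated per pair `(n, m)` (equivalent to OS's finite-sum form by linearity) for a nonzero
  purely spatial vector `a` (`a 0 = 0`, `a ≠ 0`); for `d = 1` there is no such `a` and E4 is
  vacuous (quantum mechanics has no spatial cluster property) — documented.
* `schwartzNorm m` uses Mathlib's seminorms `sup_x ‖x‖^k ‖D^l f (x)‖`, `k, l ≤ m`, instead of OS's
  `sup_{|α| ≤ m, x} (1 + |x|²)^{m/2} |D^α f (x)|`; the two are equivalent up to constants `C^m`
  (`SchwartzMap.one_add_le_sup_seminorm_apply`), which for `m = n s` are absorbed into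
  `σₙ ≤ α (n!)^β` after enlarging `α, β`, so `HasLinearGrowth` is equivalent to OS II (E0').
-/

open scoped SchwartzMap ComplexConjugate
open MeasureTheory Filter Topology Complex

noncomputable section

namespace Literature.MathematicalPhysics.QuantumLattice

/-! ### Schwartz norms of finite order -/

section SchwartzNorm

variable {X : Type*} [NormedAddCommGroup X] [NormedSpace ℝ X]

/-- The Schwartz norm of order `m` of a complex test function,
`schwartzNorm m F = max_{k, l ≤ m} sup_x ‖x‖^k ‖D^l F (x)‖`, i.e. the `Finset.sup` of Mathlib's
`schwartzSeminormFamily` over `Finset.Iic (m, m)`. Equivalent (up to constants depending on `m`)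
to Osterwalder–Schrader's `|f|_m = sup_{x, |α| ≤ m} |(1 + x²)^{m/2} (D^α f)(x)|`
(OS II, CMP 42 (1975), §2). [folklore] -/
def schwartzNorm (m : ℕ) (F : 𝓢(X, ℂ)) : ℝ :=
  ((Finset.Iic (m, m)).sup (schwartzSeminormFamily ℂ X ℂ)) F

/-- `schwartzNorm m` is (the underlying function of) a seminorm, hence nonnegative. [folklore] -/
theorem schwartzNorm_nonneg (m : ℕ) (F : 𝓢(X, ℂ)) : 0 ≤ schwartzNorm m F :=
  apply_nonneg _ _

/-- Each Schwartz seminorm `‖F‖_{k,l}` with `k, l ≤ m` is bounded by `schwartzNorm m F`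
(OS II §2: `|f|_m` dominates all seminorms of order `≤ m`). [folklore] -/
theorem seminorm_le_schwartzNorm {m k l : ℕ} (hk : k ≤ m) (hl : l ≤ m) (F : 𝓢(X, ℂ)) :
    SchwartzMap.seminorm ℂ k l F ≤ schwartzNorm m F := by
  have h : (k, l) ∈ Finset.Iic (m, m) := Finset.mem_Iic.2 ⟨hk, hl⟩
  have := Finset.le_sup (f := schwartzSeminormFamily ℂ X ℂ) h
  rw [SchwartzMap.schwartzSeminormFamily_apply] at this
  exact this F

/-- The Schwartz norms increase with the order: `|F|_m ≤ |F|_{m'}` for `m ≤ m'` (OS II §2). [folklore] -/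
theorem schwartzNorm_mono {m m' : ℕ} (h : m ≤ m') (F : 𝓢(X, ℂ)) :
    schwartzNorm m F ≤ schwartzNorm m' F := by
  have hsub : Finset.Iic (m, m) ⊆ Finset.Iic (m', m') :=
    Finset.Iic_subset_Iic.2 (Prod.mk_le_mk.2 ⟨h, h⟩)
  exact Finset.sup_mono (f := schwartzSeminormFamily ℂ X ℂ) hsub F

/-- In particular the sup norm is bounded by every Schwartz norm: `‖F x‖ ≤ |F|_m`. [folklore] -/
theorem norm_le_schwartzNorm (m : ℕ) (F : 𝓢(X, ℂ)) (x : X) : ‖F x‖ ≤ schwartzNorm m F :=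
  (SchwartzMap.norm_le_seminorm ℂ F x).trans (seminorm_le_schwartzNorm (Nat.zero_le m) (Nat.zero_le m) F)

end SchwartzNorm

/-! ### E0, E0', E1 (generic Euclidean space) -/

namespace SchwingerFamily

section Generic

variable {E : Type*} [NormedAddCommGroup E] [NormedSpace ℝ E]

/-- **E0, temperedness is automatic.** Every component `𝔖ₙ` of a Schwinger family, being a
continuous linear functional on `𝓢`, is bounded by a Schwartz norm of finite order:
`|𝔖ₙ(F)| ≤ C |F|_s` (OS 1973 §3, (E0); Mathlib: `Seminorm.bound_of_continuous` for
`schwartz_withSeminorms`). The content of (E0') is the *uniformity* of `s` and `C` in `n`. [cite: OS1973, §3  (E0] -/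
def exists_bound : Prop :=
  ∀ (S : SchwingerFamily E) (n : ℕ),
    ∃ (s : ℕ) (C : ℝ), ∀ F, ‖S n F‖ ≤ C * schwartzNorm s F

/-- **E0, normalisation** `𝔖₀ = 1` (OS 1973 §3, (E0)): the zero-point Schwinger function is the
functional `F ↦ F(pt)` on `𝓢((Fin 0 → E), ℂ) ≅ ℂ` (the unique point is the empty tuple, written
`default`). [cite: OS1973, §3  (E0] -/
def IsNormalized (S : SchwingerFamily E) : Prop :=
  ∀ F : 𝓢((Fin 0 → E), ℂ), S 0 F = F default

/-- **E0' (linear growth condition)**, Osterwalder–Schrader II, CMP 42 (1975), §2, transcribed: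

> (E0') `𝔖₀ = 1`, `𝔖ₙ ∈ 𝒮'(ℝ^{4n})`, and there exist `s ∈ ℕ` and a sequence `{σₙ}` of positive
> numbers with `σₙ ≤ α (n!)^β` for some constants `α, β`, such that
> `|𝔖ₙ(f)| ≤ σₙ |f|_{n s}` for all `n` and all `f ∈ 𝒮(ℝ^{4n})`,

where `|f|_m` is the Schwartz norm of order `m` (`schwartzNorm`, equivalent to OS's up to
constants absorbed in `α, β`). Here: `∃ s σ α β, (∀ n, σ n ≤ α (n!)^β) ∧ ∀ n F, ‖𝔖ₙ F‖ ≤ σ n *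
|F|_{n s}` (positivity of `σₙ` is immaterial and dropped; the normalisation `𝔖₀ = 1` is
`IsNormalized`, part of `IsOSFamily`). NOT part of `IsOSFamily` (outline A6, F12e). [folklore] -/
def HasLinearGrowth (S : SchwingerFamily E) : Prop :=
  ∃ (s : ℕ) (σ : ℕ → ℝ) (α β : ℝ), (∀ n, σ n ≤ α * (n.factorial : ℝ) ^ β) ∧
    ∀ (n : ℕ) (F : 𝓢((Fin n → E), ℂ)), ‖S n F‖ ≤ σ n * schwartzNorm (n * s) F

/-- Equivalent compact form of (E0'): `‖𝔖ₙ F‖ ≤ α (n!)^β |F|_{n s}` (take `σₙ = α (n!)^β`;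
conversely use `schwartzNorm_nonneg`). OS II §2. [folklore] -/
theorem hasLinearGrowth_iff (S : SchwingerFamily E) :
    S.HasLinearGrowth ↔ ∃ (s : ℕ) (α β : ℝ), ∀ (n : ℕ) (F : 𝓢((Fin n → E), ℂ)),
      ‖S n F‖ ≤ α * (n.factorial : ℝ) ^ β * schwartzNorm (n * s) F := by
  constructor
  · rintro ⟨s, σ, α, β, hσ, hS⟩
    exact ⟨s, α, β, fun n F =>
      (hS n F).trans (mul_le_mul_of_nonneg_right (hσ n) (schwartzNorm_nonneg _ _))⟩
  · rintro ⟨s, α, β, hS⟩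
    exact ⟨s, fun n => α * (n.factorial : ℝ) ^ β, α, β, fun n => le_rfl, hS⟩

/-- **E1 (Euclidean invariance)**, OS 1973 §3: `𝔖ₙ(f_{(a,R)}) = 𝔖ₙ(f)` for all translations `a`
and all linear isometries `R` acting diagonally (`translateMulti`, `linActMulti`). OS ask this
for `R ∈ SO(d)`; following Glimm–Jaffe §6.1 (OS2) and the outline we take the full `O(d)`. [cite: OS1973, §3:  𝔖ₙ(f_{(a R] -/
def IsEuclideanCovariant (S : SchwingerFamily E) : Prop :=
  (∀ (n : ℕ) (a : E) (F : 𝓢((Fin n → E), ℂ)), S n (translateMulti a F) = S n F) ∧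
    ∀ (n : ℕ) (L : E ≃ₗᵢ[ℝ] E) (F : 𝓢((Fin n → E), ℂ)), S n (linActMulti L F) = S n F

/-- Translation invariance from E1. [folklore] -/
theorem IsEuclideanCovariant.translateMulti {S : SchwingerFamily E} (hS : S.IsEuclideanCovariant)
    (n : ℕ) (a : E) (F : 𝓢((Fin n → E), ℂ)) : S n (Literature.MathematicalPhysics.QuantumLattice.translateMulti a F) = S n F :=
  hS.1 n a F

/-- Rotation/reflection invariance from E1. [folklore] -/
theorem IsEuclideanCovariant.linActMulti {S : SchwingerFamily E} (hS : S.IsEuclideanCovariant)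
    (n : ℕ) (L : E ≃ₗᵢ[ℝ] E) (F : 𝓢((Fin n → E), ℂ)) :
    S n (Literature.MathematicalPhysics.QuantumLattice.linActMulti L F) = S n F :=
  hS.2 n L F

end Generic

/-! ### E2, E4 and the OS package (fixed dimension, time = coordinate `0`) -/

section Time

variable {d : ℕ} [NeZero d]

/-- **E2 (reflection positivity)**, OS 1973 §3 and (4.2): for every finite sequence
`f = (f₀, f₁, …, f_N)`, `fₙ ∈ 𝒮₊((ℝ^d)^n)` (support in `{∀ i, xᵢ⁰ > 0}`; `f₀ ∈ ℂ`),
`∑ₙ ∑ₘ 𝔖ₙ₊ₘ(Θfₙ* ⊗ fₘ) ≥ 0`, where `(Θf*)(x₁, …, xₙ) = conj f(θxₙ, …, θx₁)` is `osAdjoint`.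
Witness form (A-D1): the tensor products `Θfₙ* ⊗ fₘ` are any `H n m` with
`IsAppendTensorOf (H n m) (osAdjoint (F n)) (F m)`; the sequence `F : ℕ → …` vanishes above `N`
and the sums run over `range (N + 1)`. "`≥ 0`" for `z : ℂ` means `0 ≤ z.re ∧ z.im = 0`. [cite: OS1973, §3 and (4.2] -/
def IsOSReflectionPositive (S : SchwingerFamily (EuclideanSpace ℝ (Fin d))) : Prop :=
  ∀ (N : ℕ) (F : (n : ℕ) → 𝓢((Fin n → EuclideanSpace ℝ (Fin d)), ℂ)),
    (∀ n, N < n → F n = 0) → (∀ n, IsPositiveTimeMulti (F n)) →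
      ∀ H : (n m : ℕ) → 𝓢((Fin (n + m) → EuclideanSpace ℝ (Fin d)), ℂ),
        (∀ n m, IsAppendTensorOf (H n m) (osAdjoint (F n)) (F m)) →
          let z := ∑ n ∈ Finset.range (N + 1), ∑ m ∈ Finset.range (N + 1), S (n + m) (H n m)
          0 ≤ z.re ∧ z.im = 0

/-- **E4 (cluster property)**, OS 1973 §3, transcribed:

> (E4) `lim_{λ → ∞} ∑ₙ,ₘ { 𝔖ₙ₊ₘ(Θfₙ* ⊗ (gₘ)_{(λa,1)}) − 𝔖ₙ(Θfₙ*) 𝔖ₘ(gₘ) } = 0`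
> for all finite sequences `f, g` in `𝒮₊` and `a = (0, a⃗)` a spatial vector,

stated per pair `(n, m)` (equivalent by linearity), for every nonzero purely spatial `a`
(`a 0 = 0`, `a ≠ 0`), with `(g)_{(λa,1)} = translateMulti (λ • a) g`, `Θf* = osAdjoint f`, and in
witness form: `H λ` is any tensor product `osAdjoint F ⊗ translateMulti (λ • a) G`. For `d = 1`
the condition is vacuous (no nonzero spatial vector). [cite: OS1973, §3  transcribed:  > (E4] -/
def HasClusterProperty (S : SchwingerFamily (EuclideanSpace ℝ (Fin d))) : Prop :=
  ∀ (n m : ℕ) (F : 𝓢((Fin n → EuclideanSpace ℝ (Fin d)), ℂ))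
    (G : 𝓢((Fin m → EuclideanSpace ℝ (Fin d)), ℂ)),
    IsPositiveTimeMulti F → IsPositiveTimeMulti G →
      ∀ a : EuclideanSpace ℝ (Fin d), a 0 = 0 → a ≠ 0 →
        ∀ H : ℝ → 𝓢((Fin (n + m) → EuclideanSpace ℝ (Fin d)), ℂ),
          (∀ t, IsAppendTensorOf (H t) (osAdjoint F) (translateMulti (t • a) G)) →
            Tendsto (fun t : ℝ => S (n + m) (H t) - S n (osAdjoint F) * S m G) atTop (𝓝 0)

/-- A Schwinger family on `ℝ^d` *satisfies the Osterwalder–Schrader axioms* (OS 1973 §3):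
normalisation `𝔖₀ = 1` (the non-automatic part of E0), E1 Euclidean invariance, E2 reflection
positivity, E3 symmetry, E4 cluster property. The linear growth condition (E0') of OS II is
deliberately NOT a field: statements needing it take `S.HasLinearGrowth` as a separate hypothesis
(outline A6, F12e; OS II, Theorem E': "(E0') ∧ (E1)–(E4) ⇒ Wightman axioms"). [cite: OS1973, §3] -/
structure IsOSFamily (S : SchwingerFamily (EuclideanSpace ℝ (Fin d))) : Prop where
  /-- E0 (normalisation): `𝔖₀ = 1`. -/
  normalized : S.IsNormalized
  /-- E1: Euclidean invariance. -/
  covariant : S.IsEuclideanCovariant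
  /-- E2: reflection positivity. -/
  reflectionPositive : S.IsOSReflectionPositive
  /-- E3: symmetry under permutations of the arguments. -/
  symmetric : S.IsSymmetric
  /-- E4: cluster property. -/
  cluster : S.HasClusterProperty

/-- Time-translation invariance of an OS family (special case of E1), in the form used with
`timeShiftTest`: `𝔖ₙ` is invariant under the diagonal translation by `t e₀`. [folklore] -/
theorem IsOSFamily.translateMulti_single {S : SchwingerFamily (EuclideanSpace ℝ (Fin d))}
    (hS : S.IsOSFamily) (n : ℕ) (t : ℝ) (F : 𝓢((Fin n → EuclideanSpace ℝ (Fin d)), ℂ)) :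
    S n (Literature.MathematicalPhysics.QuantumLattice.translateMulti (EuclideanSpace.single 0 t) F) = S n F :=
  hS.covariant.1 n _ F

/-- E2 at `N = 0`-length sequences concentrated in one degree: for a single positive-time `F` and
any witness `H` of `ΘF* ⊗ F`, `𝔖₂ₙ(ΘF* ⊗ F) ≥ 0` (OS 1973 (4.2) with one nonzero `fₙ`). [cite: OS1973, (4.2] -/
def IsOSReflectionPositive.single : Prop :=
  ∀ {S : SchwingerFamily (EuclideanSpace ℝ (Fin d))} (hS : S.IsOSReflectionPositive) {n : ℕ} (F : 𝓢((Fin n → EuclideanSpace ℝ (Fin d)), ℂ)) (hF : IsPositiveTimeMulti F) (H : 𝓢((Fin (n + n) → EuclideanSpace ℝ (Fin d)), ℂ)) (hH : IsAppendTensorOf H (osAdjoint F) F),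
    0 ≤ (S (n + n) H).re ∧ (S (n + n) H).im = 0

end Time

end SchwingerFamily

/-! ### Bridges to the measure form (Glimm–Jaffe §6.1, §19.1) -/

section Bridge

variable {E : Type*} [NormedAddCommGroup E] [NormedSpace ℝ E]
variable {d : ℕ} [NeZero d]

/-- The Schwinger family of a probability law is normalised: `𝔖₀ = 1`, since the empty moment
is `∫ 1 dμ = 1` (GJ §6.1, (6.1.4) at `n = 0`). [folklore] -/
theorem IsSchwingerFamilyOf.isNormalized {μ : Measure (FieldConfig E)} [IsProbabilityMeasure μ]
    {S : SchwingerFamily E} (hS : IsSchwingerFamilyOf μ S) : S.IsNormalized := by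
  intro F
  have hF : F = (F default) • (SchwartzMap.constOfSubsingleton 1 : 𝓢((Fin 0 → E), ℂ)) := by
    ext x
    rw [Subsingleton.elim x default]
    simp
  have h1 : S 0 (SchwartzMap.constOfSubsingleton 1) = 1 := by
    rw [hS 0 Fin.elim0 _ (fun x => by simp)]
    simp [moment]
  rw [hF, map_smul, h1, smul_eq_mul, mul_one]
  simp

/-- The Schwinger family of a law with all moments is symmetric (E3): the moments
`∫ ∏ᵢ ω(fᵢ) dμ` are symmetric in the `fᵢ`, tensor products are dense (finite dimension) and
`𝔖ₙ` is continuous. GJ §6.1; OS 1973 §3 (E3). [cite: OS1973, §3 (E3] -/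
def IsSchwingerFamilyOf.isSymmetric : Prop :=
  ∀ [FiniteDimensional ℝ E] {μ : Measure (FieldConfig E)} {S : SchwingerFamily E} (hS : IsSchwingerFamilyOf μ S) (hμ : HasAllMoments μ),
    S.IsSymmetric

/-- The Schwinger family of a Euclidean-invariant law (OS2) is Euclidean covariant (E1).
GJ §6.1; OS 1973 §3 (E1). [cite: OS1973, §3 (E1] -/
def IsSchwingerFamilyOf.isEuclideanCovariant : Prop :=
  ∀ [FiniteDimensional ℝ E] {μ : Measure (FieldConfig E)} {S : SchwingerFamily E} (hS : IsSchwingerFamilyOf μ S) (hμ : HasAllMoments μ) (h2 : IsEuclideanInvariantLaw μ),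
    S.IsEuclideanCovariant

/-- Reflection positivity passes from the measure form OS3 (positivity on exponentials
`exp (i ω(f))`, positive-time `f`) to the distributional form E2 (positivity on polynomials),
using OS0 analyticity to differentiate the generating functional. GJ §6.1 and Thm 19.1.? (§19.1,
"the Schwinger functions satisfy E2"); OS 1973 §4. Known theorem; proof deferred. [cite: OS1973, §4. Known theorem] -/
def IsSchwingerFamilyOf.isOSReflectionPositive : Prop :=
  ∀ {μ : Measure (FieldConfig (EuclideanSpace ℝ (Fin d)))} [IsProbabilityMeasure μ] {S : SchwingerFamily (EuclideanSpace ℝ (Fin d))} (hS : IsSchwingerFamilyOf μ S) (h0 : IsOS0Analytic μ) (h3 : IsOS3ReflectionPositive d μ),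
    S.IsOSReflectionPositive

/-- **From OS measures to OS Schwinger families** (Glimm–Jaffe §6.1 and §19.1; OS 1973 §3): if
`μ` satisfies the measure-form axioms OS0–OS4 and its moment functionals
`(f₁, …, fₙ) ↦ ∫ ∏ᵢ ω(fᵢ) dμ` are jointly continuous (the growth/regularity input making the
moments tempered; GJ Prop. 19.1.1 derives it from OS0–OS1), then the Schwinger functions of `μ`
exist (nuclear theorem, `existsUnique_schwingerFamilyOf`) and satisfy `𝔖₀ = 1`, E1–E4. (They
also satisfy E0', GJ Thm 19.1.4 — not asserted here, E0' being kept separate.) Known theorem;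
proof deferred. [cite: OS1973, §3] -/
def IsOSMeasure.exists_isOSFamily : Prop :=
  ∀ {μ : Measure (FieldConfig (EuclideanSpace ℝ (Fin d)))} (hμ : IsOSMeasure d μ) (hcont : ∀ n : ℕ, Continuous fun f : Fin n → 𝓢(EuclideanSpace ℝ (Fin d), ℝ) => moment μ n f),
    ∃ S : SchwingerFamily (EuclideanSpace ℝ (Fin d)), IsSchwingerFamilyOf μ S ∧ S.IsOSFamily

end Bridge

/-! ### From OS measures to OS families: E4 and the assembly of `exists_isOSFamily` -/

section Assembly

variable {d : ℕ} [NeZero d]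

/-- **E4 for the Schwinger functions of an OS measure.** If `μ` satisfies the measure-form
axioms OS0–OS4 and `S` is its Schwinger family, then `S` has the cluster property (E4) of
OS 1973 §3 (positive-time `f, g`, spatial `a = (0, a⃗)`). Printed route (a chain of three
results): (i) Glimm–Jaffe Thm 6.1.5 (p. 92): a measure with OS0–OS3 yields a Wightman theory
W1–W3 on the OS Hilbert space `𝓗`, and OS4 holds iff W4 (uniqueness of the vacuum `Ω` as the
only time-translation invariant vector) — the last equivalence being GJ Thm 19.7.1 (p. 314);
(ii) uniqueness of the vacuum and the spectral condition give the Wightman cluster property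
(R4) `W(x₁…xⱼ, xⱼ₊₁+λa, …, xₙ+λa) → W(x₁…xⱼ) W(xⱼ₊₁…xₙ)` in `𝒮'` for space-like `a`
(Streater–Wightman, Thm 3-4, "cluster decomposition property"; Ruelle's argument);
(iii) Osterwalder–Schrader 1973 §5, p. 98: "(E4) follows from (R4) by the arguments of
Section 4.4", i.e. (4.29)–(4.30): in vector notation (E4) reads
`(w(f), U_s(λa) w(g))_𝓗 → (w(f), Ω)(Ω, w(g))` for `f, g ∈ 𝒮₊`, `U_s` the unitary spatial
translations on `𝓗`. The joint continuity of the moments (`hcont`) is derivable from OS0–OS1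
(GJ Prop. 19.1.1, p. 302) and is kept only to mirror `IsOSMeasure.exists_isOSFamily` /
`existsUnique_schwingerFamilyOf` (it is the temperedness input identifying `𝔖ₙ₊ₘ` on the
non-product test functions `Θf* ⊗ g_{(λa,1)}`). Known theorem; proof deferred.
[cite: StreaterWightman2001, Thm 3-4] [cite: OsterwalderSchraderCMP1973, §5 p. 98 (E4 from R4) and §4.4 (4.29)–(4.30)] [cite: GlimmJaffeQP1987, Thm 6.1.5 and Thm 19.7.1] -/
def IsSchwingerFamilyOf.hasClusterProperty : Prop :=
  ∀ {μ : Measure (FieldConfig (EuclideanSpace ℝ (Fin d)))} (hμ : IsOSMeasure d μ)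
    (hcont : ∀ n : ℕ, Continuous fun f : Fin n → 𝓢(EuclideanSpace ℝ (Fin d), ℝ) => moment μ n f)
    {S : SchwingerFamily (EuclideanSpace ℝ (Fin d))} (hS : IsSchwingerFamilyOf μ S),
    S.HasClusterProperty

/-- **Assembly of `IsOSMeasure.exists_isOSFamily`** (Glimm–Jaffe §6.1, Prop. 6.1.4 and
Thm 6.1.5; OS 1973 §3) from its genuinely open named-fact inputs: existence of the Schwinger
family (nuclear theorem `existsUnique_schwingerFamilyOf`; its moment hypothesis `HasAllMoments`
is supplied by OS0 through the proved `IsOSMeasure.hasAllMoments`), E1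
(`IsSchwingerFamilyOf.isEuclideanCovariant`, fed by OS2), E2
(`IsSchwingerFamilyOf.isOSReflectionPositive`, fed by OS0 and OS3), E3
(`IsSchwingerFamilyOf.isSymmetric`), E4 (`IsSchwingerFamilyOf.hasClusterProperty`, fed by
OS4). The normalisation `𝔖₀ = 1` is the proved `IsSchwingerFamilyOf.isNormalized`. E1 and E3
are further reduced to the density fact `denseSpan_tensorProducts` below
(`isEuclideanCovariant_of_denseSpan`, `isSymmetric_of_denseSpan`). [cite: GlimmJaffeQP1987, §6.1 Thm 6.1.5] -/
theorem IsOSMeasure.exists_isOSFamily_of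
    (hSU : existsUnique_schwingerFamilyOf (E := EuclideanSpace ℝ (Fin d)))
    (hE1 : IsSchwingerFamilyOf.isEuclideanCovariant (E := EuclideanSpace ℝ (Fin d)))
    (hE2 : IsSchwingerFamilyOf.isOSReflectionPositive (d := d))
    (hE3 : IsSchwingerFamilyOf.isSymmetric (E := EuclideanSpace ℝ (Fin d)))
    (hE4 : IsSchwingerFamilyOf.hasClusterProperty (d := d)) :
    IsOSMeasure.exists_isOSFamily (d := d) := by
  intro μ hμ hcont
  haveI := hμ.isProbabilityMeasure
  have hall : HasAllMoments μ := hμ.hasAllMoments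
  obtain ⟨S, hS, -⟩ := hSU μ hall hcont
  exact ⟨S, hS,
    { normalized := hS.isNormalized
      covariant := hE1 hS hall hμ.os2
      reflectionPositive := hE2 hS hμ.os0 hμ.os3
      symmetric := hE3 hS hall
      cluster := hE4 hμ hcont hS }⟩

end Assembly

/-! ### Density of tensor products; E3, E1 and uniqueness reduced to it -/

section Density

variable {E : Type*} [NormedAddCommGroup E] [NormedSpace ℝ E]

/-- The set of `n`-fold tensor products `f₁ ⊗ ⋯ ⊗ fₙ` (as functions on `Fin n → E`, witness
predicate `IsTensorOf`) of complexified *real* one-point test functions `fᵢ ∈ 𝓢(E, ℝ)`: the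
test functions on which `IsSchwingerFamilyOf μ S` pins down `S` (GJ §6.1, (6.1.15); OS 1973 §2). [folklore] -/
def tensorProducts (n : ℕ) : Set 𝓢((Fin n → E), ℂ) :=
  {F | ∃ f : Fin n → 𝓢(E, ℝ), IsTensorOf F fun i => ofRealTest (f i)}

/-- Membership in `tensorProducts`. [folklore] -/
theorem mem_tensorProducts {n : ℕ} {F : 𝓢((Fin n → E), ℂ)} :
    F ∈ tensorProducts n ↔ ∃ f : Fin n → 𝓢(E, ℝ), IsTensorOf F fun i => ofRealTest (f i) :=
  Iff.rfl

/-- **Tensor products are total in `𝓢(Eⁿ)`** (Reed–Simon I, Appendix to §V.3, Thm V.13, the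
`N`-representation of `𝒮`: for `f ∈ 𝒮(ℝᵏ)` the Hermite expansion `f = ∑_α a_α φ_α`,
`φ_α(x) = ∏ᵢ φ_{αᵢ}(xᵢ)`, converges in `𝒮(ℝᵏ)`; used in Cor. 4, the nuclear theorem, and in
GJ §6.1 / OS 1973 §2 (`𝒮(ℝ^{4n}) = ⊗̂ⁿ 𝒮(ℝ⁴)`)). Consequence recorded here, for a
finite-dimensional real space `E` (≅ `ℝᵈ`, so `(Fin n → E) ≅ ℝ^{nd}` and each multi-Hermite
function is a tensor product over the `n` blocks of real Schwartz functions on `E`): the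
`ℂ`-linear span of the tensor products `f₁ ⊗ ⋯ ⊗ fₙ`, `fᵢ ∈ 𝓢(E, ℝ)`, is dense in
`𝓢((Fin n → E), ℂ)`. Mathlib has neither Hermite functions as a Schwartz basis nor any tensor
density statement for `SchwartzMap` (searched: `hermite` in `Analysis/Distribution`, `dense`
with `SchwartzMap`). Known theorem; proof deferred. [cite: ReedSimonI1980, Thm V.13 (Appendix to V.3)] -/
def denseSpan_tensorProducts : Prop :=
  ∀ [FiniteDimensional ℝ E] (n : ℕ),
    Dense (Submodule.span ℂ (tensorProducts (E := E) n) : Set 𝓢((Fin n → E), ℂ))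

/-- Two continuous linear functionals on `𝓢(Eⁿ)` that agree on all tensor products
`f₁ ⊗ ⋯ ⊗ fₙ` of real test functions coincide (density of tensor products,
`denseSpan_tensorProducts`, plus `ContinuousLinearMap.ext_on`). This is the uniqueness half of
the kernel theorem (Reed–Simon I, Thm V.12; GJ §6.1). [cite: ReedSimonI1980, Thm V.12 (uniqueness)] -/
theorem SchwingerFamily.ext_of_denseSpan [FiniteDimensional ℝ E]
    (hD : denseSpan_tensorProducts (E := E)) {n : ℕ}
    {T T' : 𝓢((Fin n → E), ℂ) →L[ℂ] ℂ}
    (h : ∀ (f : Fin n → 𝓢(E, ℝ)) (F : 𝓢((Fin n → E), ℂ)),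
      IsTensorOf F (fun i => ofRealTest (f i)) → T F = T' F) :
    T = T' :=
  ContinuousLinearMap.ext_on (hD n) fun _ ⟨f, hF⟩ => h f _ hF

/-- **Uniqueness of the Schwinger family of a law** (GJ §6.1, Prop. 6.1.4; Reed–Simon I,
Thm V.12): two Schwinger families reproducing the moments of the same `μ` on tensor products are
equal, given the density of tensor products. No moment hypothesis is needed. [cite: GlimmJaffeQP1987, §6.1 Prop. 6.1.4] -/
theorem IsSchwingerFamilyOf.unique_of_denseSpan [FiniteDimensional ℝ E]
    (hD : denseSpan_tensorProducts (E := E)) {μ : Measure (FieldConfig E)}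
    {S S' : SchwingerFamily E} (hS : IsSchwingerFamilyOf μ S) (hS' : IsSchwingerFamilyOf μ S') :
    S = S' :=
  funext fun n => SchwingerFamily.ext_of_denseSpan hD fun f F hF => by
    rw [hS n f F hF, hS' n f F hF]

/-- Moments are symmetric in their arguments: `∫ ∏ᵢ ω(f_{σ i}) dμ = ∫ ∏ᵢ ω(fᵢ) dμ`
(reindexing a finite product; GJ §6.1). No integrability is needed. [folklore] -/
theorem moment_comp_perm (μ : Measure (FieldConfig E)) {n : ℕ} (σ : Equiv.Perm (Fin n))
    (f : Fin n → 𝓢(E, ℝ)) : moment μ n (fun i => f (σ i)) = moment μ n f := by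
  unfold moment
  congr 1
  funext ω
  exact Equiv.prod_comp σ (fun i => ω (f i))

/-- **E3 for the Schwinger family of a law, from density** (OS 1973 §3 (E3); GJ §6.1):
`𝔖ₙ ∘ (·)^σ` and `𝔖ₙ` are continuous linear functionals agreeing on tensor products (where both
are the symmetric moment `∫ ∏ᵢ ω(fᵢ) dμ`, `moment_comp_perm` and `IsTensorOf.permTest`), hence
equal by `denseSpan_tensorProducts`. Discharges `IsSchwingerFamilyOf.isSymmetric` modulo the
density fact (its `HasAllMoments` hypothesis is not used). [cite: OsterwalderSchraderCMP1973, §3 (E3)] -/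
theorem IsSchwingerFamilyOf.isSymmetric_of_denseSpan (hD : denseSpan_tensorProducts (E := E)) :
    IsSchwingerFamilyOf.isSymmetric (E := E) := by
  intro _ μ S hS _ n σ F
  have h : (S n).comp (permTest σ) = S n := by
    refine SchwingerFamily.ext_of_denseSpan hD fun f G hG => ?_
    rw [ContinuousLinearMap.comp_apply, hS n f G hG,
      hS n (fun i => f (σ.symm i)) (permTest σ G) (hG.permTest σ), moment_comp_perm]
  exact DFunLike.congr_fun h F

/-- Moments are invariant under any continuous linear map `T` of test functions whose transpose
preserves the law: if `(Tᵗ)_* μ = μ` then `∫ ∏ᵢ ω(T fᵢ) dμ = ∫ ∏ᵢ ω(fᵢ) dμ` (change of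
variables `MeasureTheory.integral_map`; GJ §6.1, OS2 ⇒ E1). No integrability is needed. [folklore] -/
theorem moment_comp_of_map_act_eq {μ : Measure (FieldConfig E)} (T : 𝓢(E, ℝ) →L[ℝ] 𝓢(E, ℝ))
    (hT : μ.map (FieldConfig.act T) = μ) (n : ℕ) (f : Fin n → 𝓢(E, ℝ)) :
    moment μ n (fun i => T (f i)) = moment μ n f := by
  unfold moment
  have hmeas : Continuous fun ω : FieldConfig E => ∏ i, ω (f i) :=
    continuous_finsetProd _ fun i _ => continuous_eval_const (f i)
  calc ∫ ω, ∏ i, ω (T (f i)) ∂μ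
      = ∫ ω, (fun ω' : FieldConfig E => ∏ i, ω' (f i)) (FieldConfig.act T ω) ∂μ := by simp
    _ = ∫ ω', ∏ i, ω' (f i) ∂(μ.map (FieldConfig.act T)) :=
        (integral_map (FieldConfig.measurable_act T).aemeasurable
          hmeas.aestronglyMeasurable).symm
    _ = ∫ ω, ∏ i, ω (f i) ∂μ := by rw [hT]

/-- A Euclidean-invariant law is invariant under the transpose of every translation of test
functions: `(translateTest a)ᵗ_* μ = μ` (the motion `x ↦ x - a`; GJ §6.1, OS2). [folklore] -/
theorem IsEuclideanInvariantLaw.map_act_translateTest {μ : Measure (FieldConfig E)}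
    (hμ : IsEuclideanInvariantLaw μ) (a : E) :
    μ.map (FieldConfig.act (translateTest a : 𝓢(E, ℝ) →L[ℝ] 𝓢(E, ℝ))) = μ := by
  have h : (translateTest a : 𝓢(E, ℝ) →L[ℝ] 𝓢(E, ℝ)) =
      euclidActTest (AffineIsometryEquiv.constVAdd ℝ E (-a)).symm := by
    ext f x
    rw [translateTest_apply, euclidActTest_apply, AffineIsometryEquiv.symm_symm,
      AffineIsometryEquiv.coe_constVAdd]
    simp only [vadd_eq_add, neg_add_eq_sub]
  rw [h]
  exact hμ (AffineIsometryEquiv.constVAdd ℝ E (-a))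

/-- A Euclidean-invariant law is invariant under the transpose of every linear isometry acting
on test functions: `(linActTest L)ᵗ_* μ = μ` (GJ §6.1, OS2). [folklore] -/
theorem IsEuclideanInvariantLaw.map_act_linActTest {μ : Measure (FieldConfig E)}
    (hμ : IsEuclideanInvariantLaw μ) (L : E ≃ₗᵢ[ℝ] E) :
    μ.map (FieldConfig.act (linActTest L : 𝓢(E, ℝ) →L[ℝ] 𝓢(E, ℝ))) = μ := by
  have h : (linActTest L : 𝓢(E, ℝ) →L[ℝ] 𝓢(E, ℝ)) =
      euclidActTest (L.symm.toAffineIsometryEquiv).symm := by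
    ext f x
    rw [linActTest_apply, euclidActTest_apply, AffineIsometryEquiv.symm_symm,
      LinearIsometryEquiv.coe_toAffineIsometryEquiv]
  rw [h]
  exact hμ L.symm.toAffineIsometryEquiv

/-- Diagonal translation of a tensor product is the tensor product of the translates:
`(f₁ ⊗ ⋯ ⊗ fₙ)_{(a,1)} = (f₁)_{(a,1)} ⊗ ⋯ ⊗ (fₙ)_{(a,1)}` (OS 1973 §2). [folklore] -/
theorem IsTensorOf.translateMulti {n : ℕ} {F : 𝓢((Fin n → E), ℂ)} {f : Fin n → 𝓢(E, ℝ)}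
    (hF : IsTensorOf F fun i => ofRealTest (f i)) (a : E) :
    IsTensorOf (Literature.MathematicalPhysics.QuantumLattice.translateMulti a F) fun i => ofRealTest (translateTest a (f i)) := by
  intro x
  rw [translateMulti_apply, hF]
  rfl

/-- Diagonal action of a linear isometry on a tensor product is the tensor product of the
transformed factors (OS 1973 §2). [folklore] -/
theorem IsTensorOf.linActMulti {n : ℕ} {F : 𝓢((Fin n → E), ℂ)} {f : Fin n → 𝓢(E, ℝ)}
    (hF : IsTensorOf F fun i => ofRealTest (f i)) (L : E ≃ₗᵢ[ℝ] E) :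
    IsTensorOf (Literature.MathematicalPhysics.QuantumLattice.linActMulti L F) fun i => ofRealTest (linActTest L (f i)) := by
  intro x
  rw [linActMulti_apply, hF]
  rfl

/-- **E1 for the Schwinger family of a Euclidean-invariant law, from density** (OS 1973 §3
(E1); GJ §6.1, OS2): `𝔖ₙ ∘ (·)_{(a,R)}` and `𝔖ₙ` agree on tensor products — both are moments,
which are invariant by the change of variables `ω ↦ gᵗω` (`moment_comp_of_map_act_eq`) — hence
are equal by `denseSpan_tensorProducts`. Discharges `IsSchwingerFamilyOf.isEuclideanCovariant`
modulo the density fact (its `HasAllMoments` hypothesis is not used). [cite: OsterwalderSchraderCMP1973, §3 (E1)] -/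
theorem IsSchwingerFamilyOf.isEuclideanCovariant_of_denseSpan
    (hD : denseSpan_tensorProducts (E := E)) :
    IsSchwingerFamilyOf.isEuclideanCovariant (E := E) := by
  intro _ μ S hS _ h2
  refine ⟨fun n a F => ?_, fun n L F => ?_⟩
  · have h : (S n).comp (Literature.MathematicalPhysics.QuantumLattice.translateMulti a) = S n := by
      refine SchwingerFamily.ext_of_denseSpan hD fun f G hG => ?_
      rw [ContinuousLinearMap.comp_apply, hS n f G hG,
        hS n (fun i => translateTest a (f i)) _ (hG.translateMulti a),
        moment_comp_of_map_act_eq (translateTest a) (h2.map_act_translateTest a)]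
    exact DFunLike.congr_fun h F
  · have h : (S n).comp (Literature.MathematicalPhysics.QuantumLattice.linActMulti L) = S n := by
      refine SchwingerFamily.ext_of_denseSpan hD fun f G hG => ?_
      rw [ContinuousLinearMap.comp_apply, hS n f G hG,
        hS n (fun i => linActTest L (f i)) _ (hG.linActMulti L),
        moment_comp_of_map_act_eq (linActTest L) (h2.map_act_linActTest L)]
    exact DFunLike.congr_fun h F

end Density

end Literature.MathematicalPhysics.QuantumLattice
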